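import Summits.QuantumFields.YangMills.Theorems.BalabanLadderIRPinnedExitCofinal
import Summits.QuantumFields.YangMills.Theorems.BalabanLadderIRRankPurityCofinal
import Summits.QuantumFields.YangMills.Theses.BalabanLadder
import Summits.QuantumFields.YangMills.Theorems.IR.OpenCubeTransfer
import Literature.MathematicalPhysics.QuantumFieldTheory.WilsonFinTorusPartition
import HarnessLib

/-!
# Crux `IRcof` (stmt-QuantumFields-26930) — LINE `open-cube-continuity` (ideator ym-ir-idea-20, lens `resurrect`, gen 2)
# PXcof(1∕24) ⇐ OPEN-CUBE ANCHOR (every compact simple G) ∧ CONTINUITY IN THE CUBE SIZE (the named stall) ∧ CLOSING SEAM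
# (open → periodic at the floor-pinned cold box); N_cof by name.  Assembles BY TOKEN onto the slot of record
# `Cruxes/IRcof/Lines/pinned_cofinal_bill.lean` rev 2 {PXcof(1∕24), N_cof} (LEAD ym-ir-line-ab-p1): this file's
# `PinnedExitsCofinalAt` is that file's, VERBATIM, and `IRcof_of_stubs` concludes `Theses.BalabanLadder.IRcof` LITERALLY.

RESURRECTED ROUTES (stance: unfinished, not failed).  (i) OUR dormant route `Theses/ContractibleFibre.lean` (DORMANT 2026-08-26,
«no traction»; items `FibreAnchor` ∕ `FibreContinuity` ∕ `FibreToTorus`, target the per-β `UniformLatticeGap` body): Wilson's theory on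
the FREE tube `(ℤ/L)²×{0..M}²` is a 2-d G-gauge–Higgs system whose unique flat connection is trivial for EVERY compact G; (ii) the prior
programme's `sphere-compactification` ∕ `free-slab-reduction` (stockroom `reserve/prior-2001/Prior/QuantumFields/YangMills/`, notes
`docs/m5/inspiration/QuantumFields/YangMills/ym-sphere-compactification.md`: Gaussian theorem «ℤ²×F clusters iff H¹(F;ℝ)=0»,
two-layer free slab with a β-UNIFORM rate for ANY compact G; recorded stall «continuity in the fibre size … nothing in the method bears
on it»).  WHAT IS NEW relative to all three, and why the change is forced by the slot's currency: (a) the anchor is the OPEN CUBE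
`{0..M}³ × (ℤ/t)` (free spatial boundary, periodic Euclidean time), not a tube — a free TUBE with a periodic long direction `L` carries
the two-dimensional Yang–Mills ELECTRIC-FLUX (torelon) tail `exp(−c·L·t/(β M²))` of its residual 2-d gauge group (`FibreAnchor`'s own
volume floor `L_min(β,M) ≍ β(M+1)²`), which is INCOMPATIBLE with a floor-pinned scale `a(β)·L ≤ T` as `β → ∞`; the open cube has no
periodic spatial direction, hence no winding sector, a unique gauge orbit of flat connections (`H¹` of the cube is `0`) and a TREE-LEVEL
gap `≍ 1/M`, so its purity is uniform in `β` for EVERY compact simple `G` — centre, twist and `π₁` never enter (this is the anchor that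
line `twisted-slab-continuity` (row 43) lacks outside type `A_{N−1}` and declares as a residual); (b) the target is re-typed from the
per-β gap to PXcof(θ) in FLOOR units (cofinal in β, ONE pinned scale), so `FibreToTorus`'s «free states = symmetric torus states,
S-uniform constants by vacuum dominance» becomes ONE located-window implication at ONE box (the closing seam below); (c) the continuation
parameter is the cube size `M ↦ L` at fixed coupling, ending at the open cold box `{0..L}³ × ⌊L/4⌋`.

STUBS (four; sorries ONLY here):
* `stub_anchor : OpenCubeAnchor` — O1, LOCATED and stated for EVERY compact simple `G` (no centre, no simple connectivity): some open cube
  `{0..M₀}³` is `β`-UNIFORMLY pure along Euclidean time, `openCubeDefect ≤ C·e^{−c t}` for all `β ≥ β₀`, `t ≥ 1` (semiclassical spectral gap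
  of the transfer operator of a FINITE lattice about an isolated gauge orbit; harmonic frequencies are `β`-free).  First lemma of the line.
* `stub_continuity : CubeSizeContinuity (1/96)` — O2, **THE NAMED STALL** («continuity in the fibre size»): GIVEN the anchor at `M₀`, for
  every window floor `λ` there is `T` such that cofinally in `β` ONE scale `L ≥ max(8, M₀)` with `λ ≤ a(β)·L ≤ T` has ALL open cubes
  `{0..M}³ × ⌊L/4⌋`, `M₀ ≤ M ≤ L`, `1/96`-pure.  Width 0 at `M = L ≳ ξ`: Yang–Mills content.  Consumes `LowerBounds`.
* `stub_closingSeam : ClosingSeam (1/24)` — O3, CLOSING THE CUBE: eventually in `β`, at every `L ≥ 8` in a floor-pinned window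
  `λ ≤ a(β)·L ≤ T`, `1/96`-purity of the OPEN cold box implies `1/24`-purity of the PERIODIC cold box (`coldDefect`), i.e. adding the wrap
  plaquettes (and with them 't Hooft's electric-flux ∕ torelon sectors) costs at most that much purity — boundary-condition insensitivity
  at scales `L ≳ λ·ξ(β)`: confinement-type (heavy winding flux) AND locality-type content; no domination inequality is known here
  (contrast row 43's PROVED twist domination).  Consumes `LowerBounds`.
* `stub_irnscCof : IRnscCof` — N_cof BY NAME (slot token, `π₁(G) ≠ 1`).

PROVED here (no sorry): `pxcof_of` (anchor ⇒ continuity ⇒ endpoint `M = L` ⇒ seam ⇒ `coldDefect ≤ 1/24`, pure bookkeeping of the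
window quantifiers), `irscCof_of_pxcof` (kernel `PinnedExitCofinal.ircofSC_of_pinnedExitsCofinal_le`), `IRcof_of : Bill`,
`IRcof_of_stubs` (kernel `RankPurity.IRcof_of_split`).  NO residual stub: the anchor covers every compact simple `G`.

HONEST LABEL: ideation; SIBLING of row 43 (same move «isolate the vacuum → grow → seam», different isolating agent: free boundary instead
of centre flux, complementary scope: all `G` instead of type `A`, price: the seam has no proved domination half).  Nothing here proves
`IRcof` (0∕1), `IR`, any leg, or the Yang–Mills mass gap (Clay: NOT proved); nothing continuum ∕ OS; R4 closes only the conditional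
finite-𝕋⁴ rung `BalabanLadder.UV`.
-/

set_option autoImplicit false

noncomputable section

open Filter Topology MeasureTheory
open scoped BigOperators
open Literature.MathematicalPhysics.QuantumFieldTheory Literature.MathematicalPhysics.QuantumLattice
open Summit.QuantumFields.YangMills.Cruxes.OSLegsFromFemtoAndGap.DlrCollarTransfer (LowerBounds)
open Summit.QuantumFields.YangMills.Cruxes.IR.ColdPurityBridge (coldDefect)
open Summit.QuantumFields.YangMills.Cruxes.IR.RankPurity (IRnscCof IRscCof IRcof_of_split)
open Summit.QuantumFields.YangMills.Cruxes.IR.PinnedExitCofinal (ircofSC_of_pinnedExitsCofinal_le)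

namespace Summit.QuantumFields.YangMills.Cruxes.IRcof.OpenCubeContinuity

/-! ## §1 Currency: the open cube `{0..M}³ × (ℤ/t)` (free spatial boundary, periodic Euclidean time) -/

section Defs

variable {G : Type} [Group G] [TopologicalSpace G] [IsTopologicalGroup G] [CompactSpace G]
  [MeasurableSpace G] [BorelSpace G]

/-- Indicator of the plaquettes of the OPEN cube inside the `Fin`-torus `(M+1)³ × t`: the plaquette at `x` in the plane `(μ,ν)` is kept
iff it does not wrap spatially, i.e. `x_d < M` for every SPATIAL direction `d ∈ {μ, ν}` (time `3` stays periodic).  Spatially wrapping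
links then occur in no kept plaquette (decoupled Haar dummies): this IS Wilson's action on `{0..M}³ × (ℤ/t)` with free spatial boundary. -/
def openInd (M : ℕ) {t : ℕ} (x : FinTorusSite (M + 1) (M + 1) (M + 1) t) (μ ν : Fin 4) : ℝ :=
  if ((μ = 0 ∨ ν = 0) → (x.1 : ℕ) < M) ∧ ((μ = 1 ∨ ν = 1) → (x.2.1 : ℕ) < M) ∧ ((μ = 2 ∨ ν = 2) → (x.2.2.1 : ℕ) < M)
  then 1 else 0

/-- **The open-cube partition function** `Z^{open}_{ρ,β}(M; t) = ∫ exp(β Σ_{p ⊂ {0..M}³×(ℤ/t)} Re tr ρ(U_p)) ∏ dHaar`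
(product of normalised Haar measures over all links of the `Fin`-torus `(M+1)³ × t`; plaquettes weighted by `openInd`). -/
def openCubeZ {N : ℕ} (ρ : G →* Matrix (Fin N) (Fin N) ℂ) (β : ℝ) (M t : ℕ) : ℝ :=
  ∫ U, Real.exp (β * ∑ x : FinTorusSite (M + 1) (M + 1) (M + 1) t, ∑ q : {q : Fin 4 × Fin 4 // q.1 < q.2},
      openInd M x q.1.1 q.1.2 * (ρ (finTorusPlaquette U x q.1.1 q.1.2)).trace.re)
    ∂(Measure.pi fun _ : FinTorusSite (M + 1) (M + 1) (M + 1) t × Fin 4 => haarProbability G)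

/-- **The open-cube purity defect** along Euclidean time at period `t ↦ 2t`: `1 − Z^{open}(M; 2t) / Z^{open}(M; t)²`
(`= 1 − tr ϱ²` for the normalised thermal state of the open cube's transfer operator). -/
def openCubeDefect {N : ℕ} (ρ : G →* Matrix (Fin N) (Fin N) ℂ) (β : ℝ) (M t : ℕ) : ℝ :=
  1 - openCubeZ ρ β M (2 * t) / openCubeZ ρ β M t ^ 2

end Defs

/-! ## §1b Currency sanity BY NAME (kernel, sorry-free; helper (h2) of census row 46 = `Theorems/IR/OpenCubeTransfer.lean`,
prover ym-ir-line-pool-p3 g15, p664639, commit 1a4c0494b9d7): the open cube's transfer operator is positive (time-reflection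
positivity is blind to the spatial boundary condition), so `0 ≤ openCubeDefect < 1` — the line's currency takes no junk value. -/

section Sanity

variable {G : Type} [Group G] [TopologicalSpace G] [IsTopologicalGroup G] [CompactSpace G]
  [MeasurableSpace G] [BorelSpace G]

/-- `0 ≤ openCubeDefect r.ρ β M t` for `β ≥ 0`, `t ≥ 2` (`Z^{open}(M; 2t) ≤ Z^{open}(M; t)²`, p664639 by name). -/
theorem openCubeDefect_nonneg (r : LatticeRep G) {β : ℝ} (hβ : 0 ≤ β) (M t : ℕ) (ht : 2 ≤ t) :
    0 ≤ openCubeDefect r.ρ β M t :=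
  openCube_defect_nonneg r β M (openCubeZ r.ρ β M) (fun _ => rfl) hβ t ht

/-- `openCubeDefect r.ρ β M t < 1` (every `β`, `t`: both partition functions are positive, p664639 by name). -/
theorem openCubeDefect_lt_one (r : LatticeRep G) (β : ℝ) (M t : ℕ) :
    openCubeDefect r.ρ β M t < 1 :=
  openCube_defect_lt_one r β M (openCubeZ r.ρ β M) (fun _ => rfl) t

end Sanity

/-! ## §2 The statements -/

/-- **O1 · OPEN-CUBE ANCHOR (located; every compact simple G).**  For every compact simple `G` and every lattice representation `r`
there are a cube size `M₀ ≥ 2`, a threshold `β₀` and constants `c > 0`, `C` with `openCubeDefect r.ρ β M₀ t ≤ C · e^{−c t}` for ALL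
`β ≥ β₀` and `t ≥ 1`: the open cube has ONE gauge orbit of flat connections (it is contractible) and a tree-level gap `≍ 1/M₀`, hence
`β`-uniform purity.  No centre, no twist, no `π₁`, no floor, no unit map. -/
def OpenCubeAnchor : Prop :=
  ∀ (G : Type) [Group G] [TopologicalSpace G] [IsTopologicalGroup G] [CompactSpace G],
    IsCompactSimpleLieGroup G →
    letI : MeasurableSpace G := borel G
    haveI : BorelSpace G := ⟨rfl⟩
    ∀ r : LatticeRep G, ∃ (M₀ : ℕ) (β₀ c C : ℝ), 2 ≤ M₀ ∧ 0 < c ∧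
      ∀ β : ℝ, β₀ ≤ β → ∀ t : ℕ, 1 ≤ t → openCubeDefect r.ρ β M₀ t ≤ C * Real.exp (-(c * (t : ℝ)))

/-- **O2 · CONTINUITY IN THE CUBE SIZE — THE NAMED STALL (rank 2).**  For simply-connected compact simple `G`, every `r`, every positive
unit map `a → 0` carrying the floor `LowerBounds G r a`, and anchor data `(M₀, β₀, c, C)` as in O1: for every window floor `λ` there is
`T` such that for every `β₁` SOME `β ≥ β₁` has ONE scale `L ≥ max(8, M₀)` with `λ ≤ a(β)·L ≤ T` at which the open cubes
`{0..M}³ × ⌊L/4⌋` are `θ`-pure for EVERY size `M₀ ≤ M ≤ L` — from the anchor cube through `M·a(β) ≍ Λ⁻¹` to the open cold box `M = L`.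
The content at `M = L` is the Yang–Mills mass gap (width 0). -/
def CubeSizeContinuity (θ : ℝ) : Prop :=
  ∀ (G : Type) [Group G] [TopologicalSpace G] [IsTopologicalGroup G] [CompactSpace G],
    IsCompactSimpleLieGroup G → SimplyConnectedSpace G →
    letI : MeasurableSpace G := borel G
    haveI : BorelSpace G := ⟨rfl⟩
    ∀ (r : LatticeRep G) (a : ℝ → ℝ), (∀ β, 0 < a β) → Tendsto a atTop (𝓝 0) → LowerBounds G r a →
      ∀ (M₀ : ℕ) (β₀ c C : ℝ), 0 < c →
        (∀ β : ℝ, β₀ ≤ β → ∀ t : ℕ, 1 ≤ t → openCubeDefect r.ρ β M₀ t ≤ C * Real.exp (-(c * (t : ℝ)))) →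
        ∀ lam : ℝ, ∃ T : ℝ, ∀ β₁ : ℝ, ∃ β : ℝ, β₁ ≤ β ∧ ∃ L : ℕ, 8 ≤ L ∧ M₀ ≤ L ∧
          lam ≤ a β * (L : ℝ) ∧ a β * (L : ℝ) ≤ T ∧
          ∀ M : ℕ, M₀ ≤ M → M ≤ L → openCubeDefect r.ρ β M (L / 4) ≤ θ

/-- **O3 · CLOSING SEAM at the pinned cold box.**  For simply-connected compact simple `G`, every `r`, every positive unit map `a → 0`
carrying `LowerBounds G r a`: there is a window floor `λ` such that for every ceiling `T`, eventually in `β`, at EVERY scale `L ≥ 8` with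
`λ ≤ a(β)·L ≤ T`, `1/96`-purity of the OPEN cold box `{0..L}³ × ⌊L/4⌋` implies `θ`-purity of the PERIODIC one (`coldDefect`): closing the
cube — adding the wrap plaquettes, hence the winding electric-flux and torelon sectors — costs at most that much purity once `L ≳ λ ξ(β)`. -/
def ClosingSeam (θ : ℝ) : Prop :=
  ∀ (G : Type) [Group G] [TopologicalSpace G] [IsTopologicalGroup G] [CompactSpace G],
    IsCompactSimpleLieGroup G → SimplyConnectedSpace G →
    letI : MeasurableSpace G := borel G
    haveI : BorelSpace G := ⟨rfl⟩
    ∀ (r : LatticeRep G) (a : ℝ → ℝ), (∀ β, 0 < a β) → Tendsto a atTop (𝓝 0) → LowerBounds G r a →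
      ∃ lam : ℝ, ∀ T : ℝ, ∃ β₂ : ℝ, ∀ β : ℝ, β₂ ≤ β → ∀ L : ℕ, 8 ≤ L → lam ≤ a β * (L : ℝ) → a β * (L : ℝ) ≤ T →
        openCubeDefect r.ρ β L (L / 4) ≤ 1 / 96 → coldDefect r.ρ β L ≤ θ

/-- **PXcof(θ)** — VERBATIM the slot's `PinnedCofinalBill.PinnedExitsCofinalAt θ` (idea-11 ∕ LEAD ab-p1): one pinned `θ`-pure cold `4:1`
box at cofinally many couplings, under the floor. -/
def PinnedExitsCofinalAt (θ : ℝ) : Prop :=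
  ∀ (G : Type) [Group G] [TopologicalSpace G] [IsTopologicalGroup G] [CompactSpace G],
    IsCompactSimpleLieGroup G → SimplyConnectedSpace G →
    letI : MeasurableSpace G := borel G
    haveI : BorelSpace G := ⟨rfl⟩
    ∀ (r : LatticeRep G) (a : ℝ → ℝ), (∀ β, 0 < a β) → Tendsto a atTop (𝓝 0) → LowerBounds G r a →
      ∃ T : ℝ, ∀ β₁ : ℝ, ∃ β : ℝ, β₁ ≤ β ∧ ∃ L : ℕ, 8 ≤ L ∧ a β * (L : ℝ) ≤ T ∧ coldDefect r.ρ β L ≤ θ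

/-! ## §3 Stubs (sorries ONLY here) -/

/-- **stub O1 (open-cube anchor)** — located; first lemma of the line; every compact simple `G`. -/
theorem stub_anchor : OpenCubeAnchor := by
  sorry

/-- **stub O2 (continuity in the cube size)** — THE NAMED STALL of the resurrected routes; load-bearing, rank 2. -/
theorem stub_continuity : CubeSizeContinuity (1 / 96) := by
  sorry

/-- **stub O3 (closing seam at the pinned cold box)** — open-box purity ⇒ periodic-box purity in the floor-pinned window. -/
theorem stub_closingSeam : ClosingSeam (1 / 24) := by
  sorry

/-- **stub N_cof** — the `π₁(G) ≠ 1` conjunct of the leaf BY NAME (slot token). -/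
theorem stub_irnscCof : IRnscCof := by
  sorry

/-! ## §4 Composition (PROVED, stub-free): O1 ∧ O2 ∧ O3 ⇒ PXcof(1∕24) ⇒ IRscCof; with N_cof ⇒ `IRcof` BY NAME -/

/-- **PXcof(1∕24) from the three `π₁ = 1` obligations.**  The anchor O1 supplies `(M₀, β₀, c, C)`; the seam O3 supplies the window floor
`λ`; continuity O2 at `λ` supplies the ceiling `T` and, beyond `max(β₁, β₂(T))`, a coupling `β` and ONE floor-pinned scale `L` whose open
cubes are `1/96`-pure up to `M = L`; the seam at `(β, L)` turns the endpoint into `coldDefect r.ρ β L ≤ 1/24`. -/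
theorem pxcof_of (hA : OpenCubeAnchor) (hC : CubeSizeContinuity (1 / 96)) (hS : ClosingSeam (1 / 24)) :
    PinnedExitsCofinalAt (1 / 24) := by
  intro G _ _ _ _ hG hsc
  letI : MeasurableSpace G := borel G
  haveI : BorelSpace G := ⟨rfl⟩
  intro r a ha ha0 hlb
  obtain ⟨M₀, β₀, c, C, -, hc, hanchor⟩ := hA G hG r
  obtain ⟨lam, hS'⟩ := hS G hG hsc r a ha ha0 hlb
  obtain ⟨T, hT⟩ := hC G hG hsc r a ha ha0 hlb M₀ β₀ c C hc hanchor lam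
  obtain ⟨β₂, hβ₂⟩ := hS' T
  refine ⟨T, fun β₁ => ?_⟩
  obtain ⟨β, hβ, L, hL8, hLM, hlam, hpin, hpath⟩ := hT (max β₁ β₂)
  have hβ1 : β₁ ≤ β := le_trans (le_max_left _ _) hβ
  have hβ2 : β₂ ≤ β := le_trans (le_max_right _ _) hβ
  -- the endpoint of the path: the OPEN cold box is 1/96-pure
  have hend : openCubeDefect r.ρ β L (L / 4) ≤ 1 / 96 := hpath L hLM le_rfl
  exact ⟨β, hβ1, L, hL8, hpin, hβ₂ β hβ2 L hL8 hlam hpin hend⟩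

/-- PXcof(θ ≤ 1∕24) ⇒ the simply-connected conjunct `IRscCof` of the leaf (landed kernel `ircofSC_of_pinnedExitsCofinal_le`). -/
theorem irscCof_of_pxcof {θ : ℝ} (hθ : θ ≤ 1 / 24) (hP : PinnedExitsCofinalAt θ) : IRscCof := by
  intro G _ _ _ _ hG hsc
  exact ircofSC_of_pinnedExitsCofinal_le hθ hP G hG hsc

/-- The bill as ONE proposition (behind a `def`, so that `IRcof_of_stubs` is the file's only crux-headed theorem). -/
def Bill : Prop :=
  OpenCubeAnchor → CubeSizeContinuity (1 / 96) → ClosingSeam (1 / 24) → IRnscCof →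
    Summit.QuantumFields.YangMills.Theses.BalabanLadder.IRcof

/-- **The bill holds** (PROVED composition, stub-free): `O1 → O2 → O3 → N_cof → IRcof`. -/
theorem IRcof_of : Bill := fun hA hC hS hN =>
  IRcof_of_split (irscCof_of_pxcof le_rfl (pxcof_of hA hC hS)) hN

/-- **`IRcof` (the route's decl, literally) from the four stubs.** -/
theorem IRcof_of_stubs : Summit.QuantumFields.YangMills.Theses.BalabanLadder.IRcof :=
  IRcof_of stub_anchor stub_continuity stub_closingSeam stub_irnscCof

end Summit.QuantumFields.YangMills.Cruxes.IRcof.OpenCubeContinuity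

end
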